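import Literature.Geometry.Lorentzian.KerrDataSchwarzschildExtrinsic
import HarnessLib

/-!
# `KerrShieldedDataExist` — the UNBENT shield, chart-free analysis (part 7): the slice metric is DR at
# order zero in the areal-shift chart; the obstruction is the radial second fundamental form

Negative-side lemmas for crux `stmt-FinalStateConjecture-10055` (route SwallowTheDatum; standing disprover,
gen 4; work file `Cruxes/KerrShieldedDataExist/Disproof.lean` §7 near-miss and §13.3). Part 6
(`UnbentEndNotDR.lean`) proved that the unbent Kerr–Schild end in its TAUTOLOGICAL chart violates the
Dafermos–Rodnianski metric rate already at order zero (anisotropy `4H`). That route is chart-specific: here we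
show, for `a = 0` and the tree's closed forms `Kerr.hRep` / `Kerr.kRep` of the unbent slice data
`(Kerr.data M 0 r₀).h / .k` (`Kerr.data_h_inner_zero_apply`, `Kerr.data_k_zero_apply`), that

* in the **areal-shift chart** `x = (1 + M/‖z‖) z` (`‖x‖ = ‖z‖ + M`; `arealShift`, `hasFDerivAt_arealShift`)
  the metric IS DR-close to Schwarzschild at order zero: the exact defect `hRep_arealShift` and the bound
  `abs_hRep_arealShift_sub_le : |h_x(Dx v, Dx w) − (1 + 2M/s)⟪v, w⟫| ≤ (3M²/s²)‖v‖‖w‖` (`O(r⁻²) = o(r⁻¹)`);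
* whereas the second fundamental form has a radial component of exact size `2M/r²` relative to `h` (and hence, by the
  crux's pull-back identities, so has ANY datum `D` carrying the unbent shield: `unbentShield_radial_ratio`):
  `kRep_self`, `hRep_self`, and `kRep_self_div_ge : k_y(y, y)/h_y(y, y) ≥ M/(2‖y‖²)` for `‖y‖ ≥ 2M > 0`
  — a ratio of a `(0,2)`-tensor to the metric on the same vector, hence chart-independent, and NOT `o(r⁻²)`
  as `IsStronglyAsymptoticallyFlatDR` (`k = o₁(r⁻²)`) would require in any chart asymptotic to this one.

So the chart-free version of "the unbent shield is inadmissible" must be, and is, proved through `k`: see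
`UnbentShieldChartFreeLemmas.lean` / `UnbentShieldChartFree.lean` (`ChartFree.unbentShield_not_admissible_zero_spin`,
work file §13.4), which compare the Kerr–Schild radius with the DR chart's radius along a curve of speed `≤ √2`. Cook, Living Rev. Relativ. 3 (2000) 5,
§3.2.2, (55)–(57).
-/

set_option linter.dupNamespace false

noncomputable section

open Set
open scoped Manifold ContDiff InnerProductSpace
open Literature.Geometry.Lorentzian

namespace Summit.FinalStateConjecture.FinalStateConjecture.Theorems.KerrShieldedDataExist.Negative

section ArealShift

/-- The areal-shift chart `x = (1 + M/‖z‖) z` of `E3 ∖ 0` (`‖x‖ = ‖z‖ + M` for `M ≥ 0`). [cite: Cook2000, §3.2.2] -/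
def arealShift (M : ℝ) (z : E3) : E3 := (1 + M / ‖z‖) • z

/-- The differential of the areal shift: `v ↦ (1 + M/‖z‖) v − (M⟪z, v⟫/‖z‖³) z`. [cite: Cook2000, §3.2.2] -/
def arealShiftD (M : ℝ) (z v : E3) : E3 := (1 + M / ‖z‖) • v - (M * ⟪z, v⟫_ℝ / ‖z‖ ^ 3) • z

/-- The areal shift is differentiable off the origin, with the stated differential. [cite: Cook2000, §3.2.2] -/
theorem hasFDerivAt_arealShift (M : ℝ) {z : E3} (hz : z ≠ 0) :
    HasFDerivAt (arealShift M)
      ((1 + M / ‖z‖) • ContinuousLinearMap.id ℝ E3 +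
        ((-(1:ℕ) : ℝ) / ‖z‖ ^ (1 + 2) * M) • (E3.covec z).smulRight z) z := by
  have h1 : HasFDerivAt (fun y : E3 ↦ M * (‖y‖ ^ 1)⁻¹) (M • ((-(1 : ℕ) : ℝ) / ‖z‖ ^ (1 + 2)) • E3.covec z) z :=
    (Kerr.hasFDerivAt_inv_norm_pow hz 1).const_mul M
  have h2 : HasFDerivAt (fun y : E3 ↦ 1 + M * (‖y‖ ^ 1)⁻¹) (M • ((-(1 : ℕ) : ℝ) / ‖z‖ ^ (1 + 2)) • E3.covec z) z :=
    h1.const_add 1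
  have h3 := h2.smul (hasFDerivAt_id z)
  have hfun : arealShift M = fun y : E3 ↦ (1 + M * (‖y‖ ^ 1)⁻¹) • y := by
    funext y; simp [arealShift, div_eq_mul_inv]
  rw [hfun]
  refine h3.congr_fderiv ?_
  ext v
  simp [ContinuousLinearMap.smulRight_apply, E3.covec_apply, div_eq_mul_inv]
  ring

/-- The continuous linear map of `hasFDerivAt_arealShift` is `arealShiftD`. [cite: Cook2000, §3.2.2] -/
theorem arealShiftD_eq (M : ℝ) (z v : E3) :
    ((1 + M / ‖z‖) • ContinuousLinearMap.id ℝ E3 +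
        ((-(1:ℕ) : ℝ) / ‖z‖ ^ (1 + 2) * M) • (E3.covec z).smulRight z) v = arealShiftD M z v := by
  simp [arealShiftD, ContinuousLinearMap.smulRight_apply, E3.covec_apply, sub_eq_add_neg, div_eq_mul_inv,
    smul_smul]
  ring_nf

/-- `‖(1 + M/‖z‖) z‖ = ‖z‖ + M` for `M ≥ 0`, `z ≠ 0`. [cite: Cook2000, §3.2.2] -/
theorem norm_arealShift {M : ℝ} (hM : 0 ≤ M) {z : E3} (hz : z ≠ 0) : ‖arealShift M z‖ = ‖z‖ + M := by
  have hn : 0 < ‖z‖ := norm_pos_iff.2 hz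
  rw [arealShift, norm_smul, Real.norm_of_nonneg (by positivity)]
  field_simp

/-- **The unbent slice metric in the areal-shift chart, exact defect**: with `h = Kerr.hRep M`, `x = (1 + M/s)z`,
`s = ‖z‖`: `h_x(Dx v, Dx w) − (1 + 2M/s)⟪v, w⟫ = (M²/s²)(⟪v,w⟫ − ⟪z,v⟫⟪z,w⟫/s²) − (2M²/(s(s+M)))⟪z,v⟫⟪z,w⟫/s²`.
[cite: Cook2000, §3.2.2 (55)] -/
theorem hRep_arealShift {M : ℝ} (hM : 0 ≤ M) {z : E3} (hz : z ≠ 0) (v w : E3) :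
    Kerr.hRep M (arealShift M z) (arealShiftD M z v) (arealShiftD M z w) - (1 + 2 * M / ‖z‖) * ⟪v, w⟫_ℝ =
      M ^ 2 / ‖z‖ ^ 2 * (⟪v, w⟫_ℝ - ⟪z, v⟫_ℝ * ⟪z, w⟫_ℝ / ‖z‖ ^ 2) -
        2 * M ^ 2 / (‖z‖ * (‖z‖ + M)) * (⟪z, v⟫_ℝ * ⟪z, w⟫_ℝ / ‖z‖ ^ 2) := by
  have hn : 0 < ‖z‖ := norm_pos_iff.2 hz
  have hn' : ‖z‖ ≠ 0 := hn.ne'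
  have hsM : ‖z‖ + M ≠ 0 := by positivity
  have hzz : ⟪z, z⟫_ℝ = ‖z‖ ^ 2 := real_inner_self_eq_norm_sq z
  rw [Kerr.hRep_apply, norm_arealShift hM hz]
  simp only [arealShift, arealShiftD, inner_sub_left, inner_sub_right, inner_smul_left, inner_smul_right,
    RCLike.conj_to_real, hzz, real_inner_comm z v]
  rw [real_inner_comm w v]
  field_simp
  ring

/-- **Order-zero DR rate of the unbent slice METRIC in the areal-shift chart**:
`|h_x(Dx v, Dx w) − (1 + 2M/s)⟪v, w⟫| ≤ (3M²/s²) ‖v‖ ‖w‖`. [cite: Cook2000, §3.2.2 (55)] -/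
theorem abs_hRep_arealShift_sub_le {M : ℝ} (hM : 0 ≤ M) {z : E3} (hz : z ≠ 0) (v w : E3) :
    |Kerr.hRep M (arealShift M z) (arealShiftD M z v) (arealShiftD M z w) - (1 + 2 * M / ‖z‖) * ⟪v, w⟫_ℝ| ≤
      3 * M ^ 2 / ‖z‖ ^ 2 * (‖v‖ * ‖w‖) := by
  rw [hRep_arealShift hM hz]
  have hn : 0 < ‖z‖ := norm_pos_iff.2 hz
  set zr : E3 := (‖z‖⁻¹) • z with hzr
  have hzr1 : ‖zr‖ = 1 := by rw [hzr, norm_smul, norm_inv, norm_norm, inv_mul_cancel₀ hn.ne']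
  have hv : ⟪z, v⟫_ℝ = ‖z‖ * ⟪zr, v⟫_ℝ := by
    rw [hzr, inner_smul_left, RCLike.conj_to_real]; field_simp
  have hw : ⟪z, w⟫_ℝ = ‖z‖ * ⟪zr, w⟫_ℝ := by
    rw [hzr, inner_smul_left, RCLike.conj_to_real]; field_simp
  have hav : |⟪zr, v⟫_ℝ| ≤ ‖v‖ := by simpa [hzr1] using abs_real_inner_le_norm zr v
  have haw : |⟪zr, w⟫_ℝ| ≤ ‖w‖ := by simpa [hzr1] using abs_real_inner_le_norm zr w
  set vt : E3 := v - ⟪zr, v⟫_ℝ • zr with hvt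
  set wt : E3 := w - ⟪zr, w⟫_ℝ • zr with hwt
  have hzrzr : ⟪zr, zr⟫_ℝ = 1 := by rw [real_inner_self_eq_norm_sq, hzr1]; norm_num
  have htang : ⟪v, w⟫_ℝ - ⟪z, v⟫_ℝ * ⟪z, w⟫_ℝ / ‖z‖ ^ 2 = ⟪vt, wt⟫_ℝ := by
    rw [hv, hw, hvt, hwt]
    simp only [inner_sub_left, inner_sub_right, inner_smul_left, inner_smul_right, RCLike.conj_to_real, hzrzr,
      real_inner_comm zr v]
    rw [real_inner_comm w zr]
    field_simp
    ring
  have hvt_le : ‖vt‖ ≤ ‖v‖ := by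
    have : ‖vt‖ ^ 2 = ‖v‖ ^ 2 - ⟪zr, v⟫_ℝ ^ 2 := by
      rw [hvt, ← real_inner_self_eq_norm_sq, ← real_inner_self_eq_norm_sq]
      simp only [inner_sub_left, inner_sub_right, inner_smul_left, inner_smul_right, RCLike.conj_to_real, hzrzr,
        real_inner_comm zr v]
      ring
    nlinarith [norm_nonneg vt, norm_nonneg v, sq_nonneg ⟪zr, v⟫_ℝ]
  have hwt_le : ‖wt‖ ≤ ‖w‖ := by
    have : ‖wt‖ ^ 2 = ‖w‖ ^ 2 - ⟪zr, w⟫_ℝ ^ 2 := by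
      rw [hwt, ← real_inner_self_eq_norm_sq, ← real_inner_self_eq_norm_sq]
      simp only [inner_sub_left, inner_sub_right, inner_smul_left, inner_smul_right, RCLike.conj_to_real, hzrzr,
        real_inner_comm zr w]
      ring
    nlinarith [norm_nonneg wt, norm_nonneg w, sq_nonneg ⟪zr, w⟫_ℝ]
  have h1 : |⟪vt, wt⟫_ℝ| ≤ ‖v‖ * ‖w‖ :=
    (abs_real_inner_le_norm vt wt).trans (mul_le_mul hvt_le hwt_le (norm_nonneg _) (norm_nonneg _))
  have h2 : |⟪z, v⟫_ℝ * ⟪z, w⟫_ℝ / ‖z‖ ^ 2| ≤ ‖v‖ * ‖w‖ := by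
    rw [hv, hw, show ‖z‖ * ⟪zr, v⟫_ℝ * (‖z‖ * ⟪zr, w⟫_ℝ) / ‖z‖ ^ 2 = ⟪zr, v⟫_ℝ * ⟪zr, w⟫_ℝ by
      field_simp]
    rw [abs_mul]
    exact mul_le_mul hav haw (abs_nonneg _) (norm_nonneg _)
  rw [htang]
  have hc1 : 0 ≤ M ^ 2 / ‖z‖ ^ 2 := by positivity
  have hc2 : 0 ≤ 2 * M ^ 2 / (‖z‖ * (‖z‖ + M)) := by positivity
  have hc2' : 2 * M ^ 2 / (‖z‖ * (‖z‖ + M)) ≤ 2 * M ^ 2 / ‖z‖ ^ 2 := by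
    apply div_le_div_of_nonneg_left (by positivity) (by positivity)
    nlinarith
  calc |M ^ 2 / ‖z‖ ^ 2 * ⟪vt, wt⟫_ℝ - 2 * M ^ 2 / (‖z‖ * (‖z‖ + M)) * (⟪z, v⟫_ℝ * ⟪z, w⟫_ℝ / ‖z‖ ^ 2)|
      ≤ |M ^ 2 / ‖z‖ ^ 2 * ⟪vt, wt⟫_ℝ| + |2 * M ^ 2 / (‖z‖ * (‖z‖ + M)) * (⟪z, v⟫_ℝ * ⟪z, w⟫_ℝ / ‖z‖ ^ 2)| :=
        abs_sub _ _
    _ = M ^ 2 / ‖z‖ ^ 2 * |⟪vt, wt⟫_ℝ| + 2 * M ^ 2 / (‖z‖ * (‖z‖ + M)) * |⟪z, v⟫_ℝ * ⟪z, w⟫_ℝ / ‖z‖ ^ 2| := by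
        rw [abs_mul, abs_mul, abs_of_nonneg hc1, abs_of_nonneg hc2]
    _ ≤ M ^ 2 / ‖z‖ ^ 2 * (‖v‖ * ‖w‖) + 2 * M ^ 2 / ‖z‖ ^ 2 * (‖v‖ * ‖w‖) :=
        add_le_add (mul_le_mul_of_nonneg_left h1 hc1) (mul_le_mul hc2' h2 (abs_nonneg _) (by positivity))
    _ = 3 * M ^ 2 / ‖z‖ ^ 2 * (‖v‖ * ‖w‖) := by ring

end ArealShift

section RadialK

/-- The unbent slice metric on the position vector: `h_y(y, y) = ‖y‖² (1 + 2M/‖y‖)`. [cite: Cook2000, §3.2.2 (55)] -/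
theorem hRep_self (M : ℝ) {y : E3} (hy : y ≠ 0) : Kerr.hRep M y y y = ‖y‖ ^ 2 * (1 + 2 * M / ‖y‖) := by
  have hn : ‖y‖ ≠ 0 := norm_ne_zero_iff.2 hy
  rw [Kerr.hRep_apply, real_inner_self_eq_norm_sq]
  field_simp

/-- The unbent slice second fundamental form on the position vector (closed form `Kerr.kRep`, the tree's
`(Kerr.data M 0 r₀).k` by `Kerr.data_k_zero_apply`): `k_y(y, y) = 2M (1 + M/‖y‖)/√(1 + 2M/‖y‖)`.
[cite: Cook2000, §3.2.2 (57)] -/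
theorem kRep_self (M : ℝ) {y : E3} (hy : y ≠ 0) :
    Kerr.kRep M y y y = 2 * M * (1 + M / ‖y‖) / √(1 + 2 * M / ‖y‖) := by
  have hn : ‖y‖ ≠ 0 := norm_ne_zero_iff.2 hy
  rw [Kerr.kRep, real_inner_self_eq_norm_sq]
  field_simp
  ring

/-- **The radial second fundamental form of the unbent slice is of exact order `M/r²` relative to the metric**:
for `0 < M` and `‖y‖ ≥ 2M`, `k_y(y, y) / h_y(y, y) ≥ M/(2‖y‖²)` (indeed `= 2M(1 + M/r)/(r²(1 + 2M/r)^{3/2})`).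
Being the ratio of the `(0,2)`-tensor `k` to the metric `h` on one vector, this is chart-independent; it is the
quantity that forbids `k = o(r⁻²)` in any chart asymptotic to the Kerr–Schild one (the chart-free obstruction to
the unbent shield). [cite: Cook2000, §3.2.2 (57)] -/
theorem kRep_self_div_ge {M : ℝ} (hM : 0 < M) {y : E3} (hy : 2 * M ≤ ‖y‖) :
    M / (2 * ‖y‖ ^ 2) ≤ Kerr.kRep M y y y / Kerr.hRep M y y y := by
  have hn : 0 < ‖y‖ := by linarith
  have hy0 : y ≠ 0 := norm_pos_iff.1 hn
  rw [kRep_self M hy0, hRep_self M hy0]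
  set r := ‖y‖ with hr
  have hu : 0 < 1 + 2 * M / r := by positivity
  set S := √(1 + 2 * M / r) with hSdef
  have hS : 0 < S := Real.sqrt_pos.2 hu
  have hS2 : S ^ 2 = 1 + 2 * M / r := Real.sq_sqrt hu.le
  -- `S ≤ 3/2` since `S² = 1 + 2M/r ≤ 2 ≤ 9/4`
  have hle1 : 2 * M / r ≤ 1 := by rw [div_le_one hn]; exact hy
  have hle2 : 1 + 2 * M / r ≤ 2 := by linarith
  have hSle : S ≤ 3 / 2 := by nlinarith [hS2, hS]
  have hMr : 0 ≤ M / r := by positivity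
  have key : S ^ 2 * S ≤ 4 * (1 + M / r) := by
    rw [hS2]; nlinarith [hSle, hle2, hS.le]
  rw [← hS2, div_le_div_iff₀ (by positivity) (by positivity), div_mul_eq_mul_div, le_div_iff₀ hS]
  have hMr2 : 0 ≤ M * r ^ 2 := by positivity
  calc M * (r ^ 2 * S ^ 2) * S = (M * r ^ 2) * (S ^ 2 * S) := by ring
    _ ≤ (M * r ^ 2) * (4 * (1 + M / r)) := mul_le_mul_of_nonneg_left key hMr2
    _ = 2 * M * (1 + M / r) * (2 * r ^ 2) := by ring

/-- **Lemma A towards the chart-free unbent-shield lemma.** In ANY datum `D` on `E3` that carries the unbent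
Schwarzschild Kerr–Schild slice through `φ` (the crux's pull-back identities with `T ≡ 0`, `a = 0`), the chart-free
ratio `k/h` on the pushed-forward radial vector at `φ(y)` is at least `M/(2‖y‖²)` once `‖y‖ ≥ 2M` — so `D.k` is not
`o(r⁻²)` relative to `D.h` along the shield, whatever chart one reads the end in; what remains for the near-miss is the
comparison of the Kerr–Schild radius with the radius of the admissible end's chart. [cite: Cook2000, §3.2.2 (57)] -/
theorem unbentShield_radial_ratio [Kerr.Facts] [Kerr.SliceFacts] {M : ℝ} (hM : 0 < M) {r₁ : ℝ}
    (D : InitialDataSet (𝓡 3) E3) (φ : Kerr.slice 0 r₁ → E3)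
    (hh : ∀ y : Kerr.slice 0 r₁, pullbackBilin (I := 𝓡 3) (I' := 𝓘(ℝ, E3)) φ D.h.inner y =
      (Kerr.data M 0 r₁ hM.le).h.inner y)
    (hk : ∀ y : Kerr.slice 0 r₁, pullbackBilin (I := 𝓡 3) (I' := 𝓘(ℝ, E3)) φ D.k y =
      (Kerr.data M 0 r₁ hM.le).k y)
    (y : Kerr.slice 0 r₁) (hy : 2 * M ≤ ‖(y : E3)‖) :
    M / (2 * ‖(y : E3)‖ ^ 2) ≤
      pullbackBilin (I := 𝓡 3) (I' := 𝓘(ℝ, E3)) φ D.k y (y : E3) (y : E3) /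
        pullbackBilin (I := 𝓡 3) (I' := 𝓘(ℝ, E3)) φ D.h.inner y (y : E3) (y : E3) := by
  rw [hh y, hk y, Kerr.data_h_inner_zero_apply M hM.le y, Kerr.data_k_zero_apply M hM.le y]
  exact kRep_self_div_ge hM hy

/-- **Lemma A′ (all radii).** For `M > 0` and every `y ≠ 0`:
`k_y(y,y)/h_y(y,y) ≥ M/(‖y‖² √(1 + 2M/‖y‖)) = M/(r^{3/2}√(r + 2M))` — positive at every radius, `~ M/r²` at infinity and
`→ ∞` at the origin; so the chart-free ratio is bounded below on every bounded punctured ball as well (this serves the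
end-swapping branch of the radius comparison). [cite: Cook2000, §3.2.2 (57)] -/
theorem kRep_self_div_ge' {M : ℝ} (hM : 0 < M) {y : E3} (hy : y ≠ 0) :
    M / (‖y‖ ^ 2 * √(1 + 2 * M / ‖y‖)) ≤ Kerr.kRep M y y y / Kerr.hRep M y y y := by
  have hn : 0 < ‖y‖ := norm_pos_iff.2 hy
  rw [kRep_self M hy, hRep_self M hy]
  set r := ‖y‖ with hr
  have hu : 0 < 1 + 2 * M / r := by positivity
  set S := √(1 + 2 * M / r) with hSdef
  have hS : 0 < S := Real.sqrt_pos.2 hu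
  have hS2 : S ^ 2 = 1 + 2 * M / r := Real.sq_sqrt hu.le
  rw [← hS2, div_le_div_iff₀ (by positivity) (by positivity), div_mul_eq_mul_div, le_div_iff₀ hS]
  -- M (r² S²) S ≤ 2M(1 + M/r)(r² S) ⇔ S² ≤ 2(1 + M/r) = 1 + S²... i.e. S² ≤ 2 + 2M/r
  have key : S ^ 2 ≤ 2 * (1 + M / r) := by
    rw [hS2]
    have h1 : 2 * M / r = 2 * (M / r) := by ring
    have h2 : 0 ≤ M / r := by positivity
    linarith
  have hpos : 0 ≤ M * r ^ 2 * S := by positivity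
  calc M * (r ^ 2 * S ^ 2) * S = (M * r ^ 2 * S) * S ^ 2 := by ring
    _ ≤ (M * r ^ 2 * S) * (2 * (1 + M / r)) := mul_le_mul_of_nonneg_left key hpos
    _ = 2 * M * (1 + M / r) * (r ^ 2 * S) := by ring

end RadialK



end Summit.FinalStateConjecture.FinalStateConjecture.Theorems.KerrShieldedDataExist.Negative

end
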